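import Summits.CriticalPhenomena.SAWScalingLimit.Theorems.SAWDevelopingMapNoFoldBoundPeelCertField
import Mathlib.Analysis.SpecialFunctions.Trigonometric.Basic
import Mathlib.Tactic.IntervalCases

/-!
# The sixteen phases `e^{inπ/8}` in the number field `ℚ(√(2+√2))`

Helper file for the crux `NoFoldBound` (stmt-CriticalPhenomena-8296) of the route `SAWDevelopingMap`
(sub-problem `SAWScalingLimit` of `CriticalPhenomena`), programme FLAT / PEELED LP of the lead seats
c9–c10 (`FLAT-LEAN-DESIGN.md` on the item, layer L3 generic brick G2). Every coefficient of a row of the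
peeled LP is a phase `e^{i(3/8)W}` with `W ∈ (π/3)·ℤ`, i.e. `e^{inπ/8}` for an integer `n`; its real
and imaginary parts `cos(nπ/8)`, `sin(nπ/8)` are elements of `ℚ(t)`, `t = √(2+√2)`:
`cos(π/8) = t/2` (Mathlib's `Real.cos_pi_div_eight`), `sin(π/8) = √(2−√2)/2 = (t³ − 3t)/2`,
`cos(π/4) = (t² − 2)/2`. This file tabulates them in the reflected arithmetic `QT` of
`PeelCertField.lean` (`cosTab`, `sinTab` on residues mod 16) and proves
`cos_nat_mul_pi_div_eight`, `sin_nat_mul_pi_div_eight` (`n < 16`) and the periodic reductions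
`cos_int_mul_pi_div_eight`, `sin_int_mul_pi_div_eight`, so that a sign condition
`0 ≤ a·cos(nπ/8) + b·sin(nπ/8)` becomes `0 ≤ QT.lb …` decided by the kernel.
-/

noncomputable section

open Real

namespace QT

/-- `cos(nπ/8)` for `n mod 16`, as an element of `ℚ(t)`. -/
def cosTab (n : ℕ) : QT :=
  match n % 16 with
  | 0 => ⟨1, 0, 0, 0⟩ | 1 => ⟨0, 1/2, 0, 0⟩ | 2 => ⟨-1, 0, 1/2, 0⟩ | 3 => ⟨0, -3/2, 0, 1/2⟩
  | 4 => ⟨0, 0, 0, 0⟩ | 5 => ⟨0, 3/2, 0, -1/2⟩ | 6 => ⟨1, 0, -1/2, 0⟩ | 7 => ⟨0, -1/2, 0, 0⟩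
  | 8 => ⟨-1, 0, 0, 0⟩ | 9 => ⟨0, -1/2, 0, 0⟩ | 10 => ⟨1, 0, -1/2, 0⟩ | 11 => ⟨0, 3/2, 0, -1/2⟩
  | 12 => ⟨0, 0, 0, 0⟩ | 13 => ⟨0, -3/2, 0, 1/2⟩ | 14 => ⟨-1, 0, 1/2, 0⟩ | _ => ⟨0, 1/2, 0, 0⟩

/-- `sin(nπ/8)` for `n mod 16`, as an element of `ℚ(t)`. -/
def sinTab (n : ℕ) : QT :=
  match n % 16 with
  | 0 => ⟨0, 0, 0, 0⟩ | 1 => ⟨0, -3/2, 0, 1/2⟩ | 2 => ⟨-1, 0, 1/2, 0⟩ | 3 => ⟨0, 1/2, 0, 0⟩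
  | 4 => ⟨1, 0, 0, 0⟩ | 5 => ⟨0, 1/2, 0, 0⟩ | 6 => ⟨-1, 0, 1/2, 0⟩ | 7 => ⟨0, -3/2, 0, 1/2⟩
  | 8 => ⟨0, 0, 0, 0⟩ | 9 => ⟨0, 3/2, 0, -1/2⟩ | 10 => ⟨1, 0, -1/2, 0⟩ | 11 => ⟨0, -1/2, 0, 0⟩
  | 12 => ⟨-1, 0, 0, 0⟩ | 13 => ⟨0, -1/2, 0, 0⟩ | 14 => ⟨1, 0, -1/2, 0⟩ | _ => ⟨0, 3/2, 0, -1/2⟩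

/-! ### The three base values in terms of `t = √(2+√2)` -/

/-- `t² = 2 + √2`. -/
theorem tau_sq : Real.sqrt (2 + Real.sqrt 2) ^ 2 = 2 + Real.sqrt 2 :=
  Real.sq_sqrt (by positivity)

/-- `cos(π/8) = t/2`. -/
theorem cos_pi_div_eight_eq : Real.cos (π / 8) = Real.sqrt (2 + Real.sqrt 2) / 2 :=
  Real.cos_pi_div_eight

/-- `√(2 − √2) = t³ − 3t`. -/
theorem sqrt_two_sub_sqrt_two_eq : Real.sqrt (2 - Real.sqrt 2) = Real.sqrt (2 + Real.sqrt 2) ^ 3 - 3 * Real.sqrt (2 + Real.sqrt 2) := by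
  set t := Real.sqrt (2 + Real.sqrt 2) with ht
  have h2 : Real.sqrt 2 ^ 2 = 2 := Real.sq_sqrt (by norm_num)
  have hs2 : (1.41 : ℝ) ≤ Real.sqrt 2 := by
    rw [Real.le_sqrt (by norm_num) (by norm_num)]; norm_num
  have hs2' : Real.sqrt 2 ≤ 1.42 := by
    rw [Real.sqrt_le_left (by norm_num)]; norm_num
  have htsq : t ^ 2 = 2 + Real.sqrt 2 := tau_sq
  have htpos : 0 ≤ t := Real.sqrt_nonneg _
  have hcube : t ^ 3 - 3 * t = t * (Real.sqrt 2 - 1) := by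
    have : t ^ 3 = t * t ^ 2 := by ring
    rw [this, htsq]; ring
  have hnn : 0 ≤ t ^ 3 - 3 * t := by
    rw [hcube]; exact mul_nonneg htpos (by linarith)
  rw [Real.sqrt_eq_iff_mul_self_eq (by linarith) hnn]
  have : (t ^ 3 - 3 * t) * (t ^ 3 - 3 * t) = t ^ 2 * (Real.sqrt 2 - 1) ^ 2 := by rw [hcube]; ring
  rw [this, htsq]
  nlinarith [h2]

/-- `sin(π/8) = (t³ − 3t)/2`. -/
theorem sin_pi_div_eight_eq :
    Real.sin (π / 8) = (Real.sqrt (2 + Real.sqrt 2) ^ 3 - 3 * Real.sqrt (2 + Real.sqrt 2)) / 2 := by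
  rw [Real.sin_pi_div_eight, sqrt_two_sub_sqrt_two_eq]

/-- `cos(π/4) = (t² − 2)/2`. -/
theorem cos_pi_div_four_eq : Real.cos (π / 4) = (Real.sqrt (2 + Real.sqrt 2) ^ 2 - 2) / 2 := by
  rw [Real.cos_pi_div_four, tau_sq]; ring

/-- `sin(π/4) = (t² − 2)/2`. -/
theorem sin_pi_div_four_eq : Real.sin (π / 4) = (Real.sqrt (2 + Real.sqrt 2) ^ 2 - 2) / 2 := by
  rw [Real.sin_pi_div_four, tau_sq]; ring

/-! ### The table on `0 ≤ n < 16` -/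

/-- **`cos(nπ/8)` in `ℚ(t)`** for `n < 16`. -/
theorem cos_nat_mul_pi_div_eight (n : ℕ) (hn : n < 16) :
    Real.cos (n * π / 8) = QT.eval (Real.sqrt (2 + Real.sqrt 2)) (cosTab n) := by
  have c1 := cos_pi_div_eight_eq
  have s1 := sin_pi_div_eight_eq
  have c2 := cos_pi_div_four_eq
  have s2 := sin_pi_div_four_eq
  interval_cases n <;> simp only [cosTab, eval_mk] <;> push_cast
  · simp
  · rw [show (1 : ℝ) * π / 8 = π / 8 by ring, c1]; ring
  · rw [show (2 : ℝ) * π / 8 = π / 4 by ring, c2]; ring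
  · rw [show (3 : ℝ) * π / 8 = π / 2 - π / 8 by ring, Real.cos_pi_div_two_sub, s1]; ring
  · rw [show (4 : ℝ) * π / 8 = π / 2 by ring, Real.cos_pi_div_two]; ring
  · rw [show (5 : ℝ) * π / 8 = π / 8 + π / 2 by ring, Real.cos_add_pi_div_two, s1]; ring
  · rw [show (6 : ℝ) * π / 8 = π - π / 4 by ring, Real.cos_pi_sub, c2]; ring
  · rw [show (7 : ℝ) * π / 8 = π - π / 8 by ring, Real.cos_pi_sub, c1]; ring
  · rw [show (8 : ℝ) * π / 8 = π by ring, Real.cos_pi]; ring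
  · rw [show (9 : ℝ) * π / 8 = π / 8 + π by ring, Real.cos_add_pi, c1]; ring
  · rw [show (10 : ℝ) * π / 8 = π / 4 + π by ring, Real.cos_add_pi, c2]; ring
  · rw [show (11 : ℝ) * π / 8 = (π / 2 - π / 8) + π by ring, Real.cos_add_pi, Real.cos_pi_div_two_sub, s1]
    ring
  · rw [show (12 : ℝ) * π / 8 = π / 2 + π by ring, Real.cos_add_pi, Real.cos_pi_div_two]; ring
  · rw [show (13 : ℝ) * π / 8 = (π / 8 + π / 2) + π by ring, Real.cos_add_pi, Real.cos_add_pi_div_two, s1]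
    ring
  · rw [show (14 : ℝ) * π / 8 = (π - π / 4) + π by ring, Real.cos_add_pi, Real.cos_pi_sub, c2]; ring
  · rw [show (15 : ℝ) * π / 8 = (π - π / 8) + π by ring, Real.cos_add_pi, Real.cos_pi_sub, c1]; ring

/-- **`sin(nπ/8)` in `ℚ(t)`** for `n < 16`. -/
theorem sin_nat_mul_pi_div_eight (n : ℕ) (hn : n < 16) :
    Real.sin (n * π / 8) = QT.eval (Real.sqrt (2 + Real.sqrt 2)) (sinTab n) := by
  have c1 := cos_pi_div_eight_eq
  have s1 := sin_pi_div_eight_eq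
  have c2 := cos_pi_div_four_eq
  have s2 := sin_pi_div_four_eq
  interval_cases n <;> simp only [sinTab, eval_mk] <;> push_cast
  · simp
  · rw [show (1 : ℝ) * π / 8 = π / 8 by ring, s1]; ring
  · rw [show (2 : ℝ) * π / 8 = π / 4 by ring, s2]; ring
  · rw [show (3 : ℝ) * π / 8 = π / 2 - π / 8 by ring, Real.sin_pi_div_two_sub, c1]; ring
  · rw [show (4 : ℝ) * π / 8 = π / 2 by ring, Real.sin_pi_div_two]; ring
  · rw [show (5 : ℝ) * π / 8 = π / 8 + π / 2 by ring, Real.sin_add_pi_div_two, c1]; ring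
  · rw [show (6 : ℝ) * π / 8 = π - π / 4 by ring, Real.sin_pi_sub, s2]; ring
  · rw [show (7 : ℝ) * π / 8 = π - π / 8 by ring, Real.sin_pi_sub, s1]; ring
  · rw [show (8 : ℝ) * π / 8 = π by ring, Real.sin_pi]; ring
  · rw [show (9 : ℝ) * π / 8 = π / 8 + π by ring, Real.sin_add_pi, s1]; ring
  · rw [show (10 : ℝ) * π / 8 = π / 4 + π by ring, Real.sin_add_pi, s2]; ring
  · rw [show (11 : ℝ) * π / 8 = (π / 2 - π / 8) + π by ring, Real.sin_add_pi, Real.sin_pi_div_two_sub, c1]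
    ring
  · rw [show (12 : ℝ) * π / 8 = π / 2 + π by ring, Real.sin_add_pi, Real.sin_pi_div_two]; ring
  · rw [show (13 : ℝ) * π / 8 = (π / 8 + π / 2) + π by ring, Real.sin_add_pi, Real.sin_add_pi_div_two, c1]
    ring
  · rw [show (14 : ℝ) * π / 8 = (π - π / 4) + π by ring, Real.sin_add_pi, Real.sin_pi_sub, s2]; ring
  · rw [show (15 : ℝ) * π / 8 = (π - π / 8) + π by ring, Real.sin_add_pi, Real.sin_pi_sub, s1]; ring

/-! ### All integers, by periodicity -/

/-- `cosTab` and `sinTab` only depend on the residue mod 16. -/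
theorem cosTab_mod (n : ℕ) : cosTab (n % 16) = cosTab n := by simp [cosTab]
/-- `sinTab` only depends on the residue mod 16. -/
theorem sinTab_mod (n : ℕ) : sinTab (n % 16) = sinTab n := by simp [sinTab]

/-- Reduction of the angle `mπ/8` modulo `2π`: `m = 16k + r`. -/
theorem angle_reduce (m : ℤ) :
    (m : ℝ) * π / 8 = ((m % 16).toNat : ℕ) * π / 8 + (m / 16 : ℤ) * (2 * π) := by
  have h0 : 0 ≤ m % 16 := Int.emod_nonneg _ (by norm_num)
  have h1 : ((m % 16).toNat : ℤ) = m % 16 := Int.toNat_of_nonneg h0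
  have hdiv : m = 16 * (m / 16) + m % 16 := (Int.mul_ediv_add_emod m 16).symm  -- `Int.ediv_add_emod`
  have : (m : ℝ) = 16 * ((m / 16 : ℤ) : ℝ) + (((m % 16).toNat : ℕ) : ℝ) := by
    have e : (((m % 16).toNat : ℕ) : ℝ) = ((m % 16 : ℤ) : ℝ) := by exact_mod_cast h1
    rw [e]; exact_mod_cast hdiv
  rw [this]; ring

/-- **`cos(mπ/8)` in `ℚ(t)`** for every integer `m`. -/
theorem cos_int_mul_pi_div_eight (m : ℤ) :
    Real.cos (m * π / 8) = QT.eval (Real.sqrt (2 + Real.sqrt 2)) (cosTab (m % 16).toNat) := by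
  rw [angle_reduce m, Real.cos_add_int_mul_two_pi]
  exact cos_nat_mul_pi_div_eight _ (by
    have := Int.emod_lt_of_pos m (by norm_num : (0 : ℤ) < 16)
    have h0 : 0 ≤ m % 16 := Int.emod_nonneg _ (by norm_num)
    omega)

/-- **`sin(mπ/8)` in `ℚ(t)`** for every integer `m`. -/
theorem sin_int_mul_pi_div_eight (m : ℤ) :
    Real.sin (m * π / 8) = QT.eval (Real.sqrt (2 + Real.sqrt 2)) (sinTab (m % 16).toNat) := by
  rw [angle_reduce m, Real.sin_add_int_mul_two_pi]
  exact sin_nat_mul_pi_div_eight _ (by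
    have := Int.emod_lt_of_pos m (by norm_num : (0 : ℤ) < 16)
    have h0 : 0 ≤ m % 16 := Int.emod_nonneg _ (by norm_num)
    omega)

/-- **The row phase.** `e^{i(3/8)W}` for `W = (π/3)·m`: real part `cos(mπ/8)`, imaginary part
`sin(mπ/8)`, both in `ℚ(t)`. -/
theorem exp_row_phase (m : ℤ) :
    Complex.exp (Complex.I * (3 / 8 : ℝ) * (((Real.pi / 3 * m : ℝ)) : ℂ)) =
      ⟨QT.eval (Real.sqrt (2 + Real.sqrt 2)) (cosTab (m % 16).toNat),
        QT.eval (Real.sqrt (2 + Real.sqrt 2)) (sinTab (m % 16).toNat)⟩ := by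
  have e : Complex.I * (3 / 8 : ℝ) * (((Real.pi / 3 * m : ℝ)) : ℂ) = ((m * π / 8 : ℝ) : ℂ) * Complex.I := by
    push_cast; ring
  rw [e, Complex.exp_mul_I, ← Complex.ofReal_cos, ← Complex.ofReal_sin, cos_int_mul_pi_div_eight,
    sin_int_mul_pi_div_eight]
  apply Complex.ext <;> simp

end QT
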